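import Literature.NumberTheory.Sieve.FordMaynardSlicePermutation
import Mathlib.Logic.Equiv.Fin.Rotate
import Mathlib.MeasureTheory.Integral.Prod
import HarnessLib

/-!
# Slice integrals: Fubini in blocks (`sliceIntegral_append`, `multiSlice`)

Everything here is PROVED. Continuation of `FordMaynardSliceConvolution.lean` /
`FordMaynardSlicePermutation.lean`; the measure-theoretic backbone for Ford–Maynard's
fragmentation relations (arXiv:2407.14368, Theorem 6.4, (fsl), (6.3)), where variables are
integrated "over `ξ_j = u_{j,1} + ⋯ + u_{j,k_j}`, `1 ≤ j ≤ m`".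

* helpers: `sliceIntegral_comp_cast` (relabelling along `d = d'`), parametric measurability
  `measurable_sliceIntegral_param`, bounds `abs_sliceIntegral_le`, `abs_sliceIntegral_le_pow`,
  `sliceIntegral_eq_zero_of_nonpos`;
* `sliceIntegral_succ_succ_snoc` / `sliceIntegral_peel_last`: peeling off the *last* coordinate
  (from the first-coordinate version via the rotation `finRotate` and permutation invariance);
* Fubini-type swaps: `setIntegral_antidiag_swap` (triangle `{s,t>0, s+t≤w}`),
  `sliceIntegral_setIntegral_swap`, `sliceIntegral_sliceIntegral_swap`,
  `sliceIntegral_multiSlice_swap`;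
* **`sliceIntegral_append`** (two blocks):
  `∫_{Δ_{(a+1)+(b+1)}(w)} G = ∫_0^w ∫_{v ∈ Δ_{a+1}(t)} ∫_{u ∈ Δ_{b+1}(w−t)} G(v,u) dt`;
* `bsum`, **`multiSlice s h ψ H`** = `∫_{v₀ ∈ Δ_{h₀}(ψ₀)} ⋯ ∫_{v_{s−1} ∈ Δ_{h_{s−1}}(ψ_{s−1})} H(v₀,…,v_{s−1})`
  (consecutive blocks), its measurability/bounds/linearity, and the **multi-block Fubini formula**
  `sliceIntegral_multiSlice`: `∫_{ψ ∈ Δ_s(w)} multiSlice s h ψ H = ∫_{Δ_{Σh}(w)} H` (all `h_j ≥ 1`).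

Here `Δ_k(t) = {v ∈ (0,∞)^k : v₁ + ⋯ + v_k = t}` with the projection measure of `sliceIntegral`
(`Literature/NumberTheory/Sieve/FordMaynardFramework.lean`).
-/

noncomputable section

open MeasureTheory Finset Set

namespace Literature.NumberTheory.Sieve.FordMaynard

/-! ### Transport along `Fin.cast` -/

/-- Slice integrals are invariant under relabelling `Fin d ≃ Fin d'` along `d = d'`. [folklore] -/
theorem sliceIntegral_comp_cast {d d' : ℕ} (h : d = d') (w : ℝ) (G : (Fin d → ℝ) → ℝ) :
    sliceIntegral d' w (fun u => G (u ∘ Fin.cast h)) = sliceIntegral d w G := by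
  subst h; rfl

/-! ### Parametric measurability -/

/-- Joint measurability of the slice integrand in a parameter and the free coordinates. [folklore] -/
theorem measurable_sliceIntegrand_param {X : Type*} [MeasurableSpace X] (d : ℕ) {w : X → ℝ}
    (hw : Measurable w) {G : X → (Fin (d + 1) → ℝ) → ℝ}
    (hG : Measurable fun q : X × (Fin (d + 1) → ℝ) => G q.1 q.2) :
    Measurable fun q : X × (Fin d → ℝ) => sliceIntegrand d (w q.1) (G q.1) q.2 := by
  unfold sliceIntegrand
  refine Measurable.ite ?_ ?_ measurable_const
  · refine MeasurableSet.inter ?_ ?_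
    · have : MeasurableSet {q : X × (Fin d → ℝ) | ∀ i, 0 < q.2 i} := by
        have h : {q : X × (Fin d → ℝ) | ∀ i, 0 < q.2 i} = ⋂ i, {q | 0 < q.2 i} := by
          ext q; simp
        rw [h]
        exact MeasurableSet.iInter fun i =>
          measurableSet_lt measurable_const ((measurable_pi_apply i).comp measurable_snd)
      exact this
    · exact measurableSet_lt (Finset.measurable_sum _ fun i _ =>
        (measurable_pi_apply i).comp measurable_snd) (hw.comp measurable_fst)
  · have hs : Measurable fun q : X × (Fin d → ℝ) =>
        (Fin.snoc q.2 (w q.1 - ∑ i, q.2 i) : Fin (d + 1) → ℝ) := by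
      refine measurable_pi_iff.2 fun j => ?_
      refine Fin.lastCases ?_ (fun i => ?_) j
      · simp only [Fin.snoc_last]
        exact (hw.comp measurable_fst).sub
          (Finset.measurable_sum _ fun i _ => (measurable_pi_apply i).comp measurable_snd)
      · simp only [Fin.snoc_castSucc]
        exact (measurable_pi_apply i).comp measurable_snd
    exact hG.comp (measurable_fst.prodMk hs)

/-- **Parametric slice integrals are measurable in the parameter.** [folklore] -/
theorem measurable_sliceIntegral_param {X : Type*} [MeasurableSpace X] (d : ℕ) {w : X → ℝ}
    (hw : Measurable w) {G : X → (Fin d → ℝ) → ℝ}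
    (hG : Measurable fun q : X × (Fin d → ℝ) => G q.1 q.2) :
    Measurable fun p => sliceIntegral d (w p) (G p) := by
  cases d with
  | zero => exact measurable_const
  | succ d =>
    simp_rw [sliceIntegral_succ_eq]
    have hsm : StronglyMeasurable
        (Function.uncurry fun (p : X) (u : Fin d → ℝ) => sliceIntegrand d (w p) (G p) u) :=
      (measurable_sliceIntegrand_param d hw hG).stronglyMeasurable
    exact (hsm.integral_prod_right (ν := volume)).measurable

/-! ### A crude bound -/

/-- `|sliceIntegral (d+1) w G| ≤ C w^d` if `|G| ≤ C` on the slice (`w ≥ 0`). [folklore] -/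
theorem abs_sliceIntegral_le (d : ℕ) {w : ℝ} (hw : 0 ≤ w) {G : (Fin (d + 1) → ℝ) → ℝ} {C : ℝ}
    (hC : 0 ≤ C) (hGb : ∀ v : Fin (d + 1) → ℝ, (∀ i, 0 < v i) → ∑ i, v i = w → |G v| ≤ C) :
    |sliceIntegral (d + 1) w G| ≤ C * w ^ d := by
  rw [sliceIntegral_succ_eq]
  set cube : Set (Fin d → ℝ) := Set.pi Set.univ fun _ => Set.Ioo 0 w with hcube
  have hsupp : ∀ u, u ∉ cube → sliceIntegrand d w G u = 0 := by
    intro u hu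
    apply sliceIntegrand_eq_zero
    intro h
    apply hu
    rw [hcube, Set.mem_univ_pi]
    exact fun i => h i
  have heq : ∫ u, sliceIntegrand d w G u = ∫ u in cube, sliceIntegrand d w G u := by
    rw [← integral_indicator (MeasurableSet.univ_pi fun _ => measurableSet_Ioo)]
    refine integral_congr_ae (Filter.Eventually.of_forall fun u => ?_)
    by_cases hu : u ∈ cube
    · rw [Set.indicator_of_mem hu]
    · rw [Set.indicator_of_notMem hu, hsupp u hu]
  rw [heq]
  have hvol : volume cube = ENNReal.ofReal (w ^ d) := by
    rw [hcube, Real.volume_pi_Ioo]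
    simp only [sub_zero, Finset.prod_const, Finset.card_univ, Fintype.card_fin]
    rw [ENNReal.ofReal_pow hw]
  have hfin : volume cube < ⊤ := by rw [hvol]; exact ENNReal.ofReal_lt_top
  have := norm_setIntegral_le_of_norm_le_const hfin
    (fun u _ => (Real.norm_eq_abs _).le.trans (abs_sliceIntegrand_le d w hC hGb u))
  rw [Real.norm_eq_abs] at this
  simpa only [Measure.real, hvol, ENNReal.toReal_ofReal (pow_nonneg hw d)] using this

/-- Slice integrals over slices with nonpositive total vanish. [folklore] -/
theorem sliceIntegral_eq_zero_of_nonpos (d : ℕ) {w : ℝ} (hw : w ≤ 0) (G : (Fin d → ℝ) → ℝ) :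
    sliceIntegral d w G = 0 := by
  cases d with
  | zero => rfl
  | succ d =>
    rw [sliceIntegral_succ_eq]
    exact integral_eq_zero_of_ae (Filter.Eventually.of_forall fun u =>
      sliceIntegrand_eq_zero_of_nonpos d hw G u)

/-- `|sliceIntegral (d+1) w G| ≤ C R^d` for `w ≤ R`, if `|G| ≤ C` everywhere. [folklore] -/
theorem abs_sliceIntegral_le' (d : ℕ) {w R : ℝ} (hR : 0 ≤ R) (hwR : w ≤ R)
    {G : (Fin (d + 1) → ℝ) → ℝ} {C : ℝ} (hC : 0 ≤ C) (hGb : ∀ v, |G v| ≤ C) :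
    |sliceIntegral (d + 1) w G| ≤ C * R ^ d := by
  rcases le_or_gt w 0 with hw | hw
  · rw [sliceIntegral_eq_zero_of_nonpos _ hw, abs_zero]; positivity
  · exact (abs_sliceIntegral_le d hw.le hC (fun v _ _ => hGb v)).trans
      (mul_le_mul_of_nonneg_left (pow_le_pow_left₀ hw.le hwR d) hC)

/-! ### Peeling off the last coordinate -/

/-- **Peeling off the last coordinate**:
`∫_{|z|=w, z ∈ (0,∞)^{d+2}} G = ∫_{0<t≤w} ∫_{|v| = w−t, v ∈ (0,∞)^{d+1}} G(v, t) dt`. [folklore] -/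
theorem sliceIntegral_succ_succ_snoc (d : ℕ) (w : ℝ) {G : (Fin (d + 2) → ℝ) → ℝ} (hG : Measurable G)
    {C : ℝ} (hC : 0 ≤ C) (hGb : ∀ v : Fin (d + 2) → ℝ, (∀ i, 0 < v i) → ∑ i, v i = w → |G v| ≤ C) :
    sliceIntegral (d + 2) w G =
      ∫ t in Set.Ioc 0 w, sliceIntegral (d + 1) (w - t) (fun v => G (Fin.snoc v t)) := by
  -- `G (snoc v t) = G' (cons t v)` with `G' = G ∘ (· ∘ finRotate)`
  set G' : (Fin (d + 2) → ℝ) → ℝ := fun z => G (z ∘ finRotate (d + 2)) with hG'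
  have hperm : sliceIntegral (d + 2) w G' = sliceIntegral (d + 2) w G :=
    sliceIntegral_comp_perm w (finRotate (d + 2)) G
  rw [← hperm, sliceIntegral_succ_succ d w (G := G')
    (hG.comp (measurable_pi_iff.2 fun i => measurable_pi_apply _)) hC (fun v hv hs =>
      hGb _ (fun i => hv _) (by rw [← hs]; exact Equiv.sum_comp (finRotate (d + 2)) v))]
  refine setIntegral_congr_fun measurableSet_Ioc fun t _ => ?_
  congr 1
  funext v
  rw [Fin.snoc_eq_cons_rotate]
  rfl

/-- The same in the form `d + 1`, `1 ≤ d`. [folklore] -/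
theorem sliceIntegral_peel_last {d : ℕ} (hd : 1 ≤ d) (w : ℝ) {G : (Fin (d + 1) → ℝ) → ℝ}
    (hG : Measurable G) {C : ℝ} (hC : 0 ≤ C)
    (hGb : ∀ v : Fin (d + 1) → ℝ, (∀ i, 0 < v i) → ∑ i, v i = w → |G v| ≤ C) :
    sliceIntegral (d + 1) w G =
      ∫ t in Set.Ioc 0 w, sliceIntegral d (w - t) (fun v => G (Fin.snoc v t)) := by
  obtain ⟨e, rfl⟩ : ∃ e, d = e + 1 := ⟨d - 1, by omega⟩
  exact sliceIntegral_succ_succ_snoc e w hG hC hGb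

/-! ### Two Fubini-type swaps -/

/-- Fubini over the triangle `{s, t > 0, s + t ≤ w}`. [folklore] -/
theorem setIntegral_antidiag_swap {w : ℝ} {K : ℝ → ℝ → ℝ} (hK : Measurable (Function.uncurry K))
    {M : ℝ} (hM : ∀ t ∈ Set.Ioc 0 w, ∀ s ∈ Set.Ioc 0 w, |K t s| ≤ M) :
    ∫ t in Set.Ioc 0 w, ∫ s in Set.Ioc 0 (w - t), K t s =
      ∫ s in Set.Ioc 0 w, ∫ t in Set.Ioc 0 (w - s), K t s := by
  set μ : Measure ℝ := volume.restrict (Set.Ioc 0 w) with hμ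
  haveI : IsFiniteMeasure μ := ⟨by rw [hμ, Measure.restrict_apply_univ]; exact measure_Ioc_lt_top⟩
  set F : ℝ → ℝ → ℝ := fun t s => if s ≤ w - t then K t s else 0 with hF
  have hFm : Measurable (Function.uncurry F) := by
    refine Measurable.ite ?_ hK measurable_const
    exact measurableSet_le measurable_snd (measurable_const.sub measurable_fst)
  have hFi : Integrable (Function.uncurry F) (μ.prod μ) := by
    refine Integrable.of_bound (C := max M 0) hFm.aestronglyMeasurable ?_
    have hae : ∀ᵐ p : ℝ × ℝ ∂(μ.prod μ), p ∈ Set.Ioc 0 w ×ˢ Set.Ioc 0 w := by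
      rw [hμ, Measure.prod_restrict]
      exact ae_restrict_mem (measurableSet_Ioc.prod measurableSet_Ioc)
    filter_upwards [hae] with p hp
    simp only [Function.uncurry, hF, Real.norm_eq_abs]
    split_ifs
    · exact (hM p.1 hp.1 p.2 hp.2).trans (le_max_left _ _)
    · rw [abs_zero]; exact le_max_right _ _
  have hswap := integral_integral_swap hFi
  -- identify both sides
  have hL : ∫ t in Set.Ioc 0 w, ∫ s in Set.Ioc 0 (w - t), K t s = ∫ t, ∫ s, F t s ∂μ ∂μ := by
    refine setIntegral_congr_fun measurableSet_Ioc fun t ht => ?_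
    rw [hμ]
    rw [← integral_indicator measurableSet_Ioc, ← integral_indicator measurableSet_Ioc]
    refine integral_congr_ae (Filter.Eventually.of_forall fun s => ?_)
    simp only [Set.indicator, Set.mem_Ioc, hF]
    by_cases hs : 0 < s
    · by_cases hsw : s ≤ w - t
      · rw [if_pos ⟨hs, hsw⟩, if_pos ⟨hs, by linarith [ht.1]⟩, if_pos hsw]
      · rw [if_neg (fun h => hsw h.2)]
        split_ifs <;> rfl
    · rw [if_neg (fun h => hs h.1), if_neg (fun h => hs h.1)]
  have hR : ∫ s in Set.Ioc 0 w, ∫ t in Set.Ioc 0 (w - s), K t s = ∫ s, ∫ t, F t s ∂μ ∂μ := by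
    refine setIntegral_congr_fun measurableSet_Ioc fun s hs => ?_
    rw [hμ]
    rw [← integral_indicator measurableSet_Ioc, ← integral_indicator measurableSet_Ioc]
    refine integral_congr_ae (Filter.Eventually.of_forall fun t => ?_)
    simp only [Set.indicator, Set.mem_Ioc, hF]
    by_cases ht : 0 < t
    · by_cases htw : t ≤ w - s
      · rw [if_pos ⟨ht, htw⟩, if_pos ⟨ht, by linarith [hs.1]⟩, if_pos (by linarith)]
      · rw [if_neg (fun h => htw h.2)]
        by_cases htw' : t ≤ w
        · rw [if_pos ⟨ht, htw'⟩, if_neg (by intro h; exact htw (by linarith))]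
        · rw [if_neg (fun h => htw' h.2)]
    · rw [if_neg (fun h => ht h.1), if_neg (fun h => ht h.1)]
  rw [hL, hR, hswap]

/-- Fubini between a slice integral and an interval integral (bounded measurable integrands).
[folklore] -/
theorem sliceIntegral_setIntegral_swap (d : ℕ) (τ : ℝ) {a b : ℝ} {Ψ : (Fin (d + 1) → ℝ) → ℝ → ℝ}
    (hΨ : Measurable (Function.uncurry Ψ)) {M : ℝ} (hM : ∀ v, ∀ s ∈ Set.Ioc a b, |Ψ v s| ≤ M) :
    sliceIntegral (d + 1) τ (fun v => ∫ s in Set.Ioc a b, Ψ v s) =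
      ∫ s in Set.Ioc a b, sliceIntegral (d + 1) τ (fun v => Ψ v s) := by
  rw [sliceIntegral_succ_eq]
  simp_rw [sliceIntegral_succ_eq]
  -- the slice integrand of the parametric integral is the parametric integral of slice integrands
  have hpt : ∀ u : Fin d → ℝ, sliceIntegrand d τ (fun v => ∫ s in Set.Ioc a b, Ψ v s) u =
      ∫ s in Set.Ioc a b, sliceIntegrand d τ (fun v => Ψ v s) u := by
    intro u
    unfold sliceIntegrand
    split_ifs
    · rfl
    · simp
  simp_rw [hpt]
  -- both integrands are supported in the cube `(0, max τ 0)^d`; use Fubini for the finite measure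
  set cube : Set (Fin d → ℝ) := Set.pi Set.univ fun _ => Set.Ioo 0 τ with hcube
  have hcubem : MeasurableSet cube := MeasurableSet.univ_pi fun _ => measurableSet_Ioo
  have hcubefin : volume cube < ⊤ := by
    rw [hcube, Real.volume_pi_Ioo]; simp [ENNReal.ofReal_lt_top]
  have hsupp : ∀ s u, u ∉ cube → sliceIntegrand d τ (fun v => Ψ v s) u = 0 := by
    intro s u hu
    apply sliceIntegrand_eq_zero
    intro h; apply hu; rw [hcube, Set.mem_univ_pi]; exact fun i => h i
  haveI : IsFiniteMeasure (volume.restrict cube : Measure (Fin d → ℝ)) :=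
    ⟨by rw [Measure.restrict_apply_univ]; exact hcubefin⟩
  haveI : IsFiniteMeasure (volume.restrict (Set.Ioc a b) : Measure ℝ) :=
    ⟨by rw [Measure.restrict_apply_univ]; exact measure_Ioc_lt_top⟩
  have hFm : Measurable (Function.uncurry fun (u : Fin d → ℝ) (s : ℝ) => sliceIntegrand d τ (fun v => Ψ v s) u) := by
    have := measurable_sliceIntegrand_param (X := ℝ) d (w := fun _ => τ) measurable_const
      (G := fun s v => Ψ v s) (hΨ.comp (measurable_snd.prodMk measurable_fst))
    exact this.comp measurable_swap
  have hCb : ∀ u, ∀ s ∈ Set.Ioc a b, |sliceIntegrand d τ (fun v => Ψ v s) u| ≤ max M 0 := by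
    intro u s hs
    unfold sliceIntegrand
    split_ifs
    · exact (hM _ s hs).trans (le_max_left _ _)
    · rw [abs_zero]; exact le_max_right _ _
  have hFi : Integrable (Function.uncurry fun (u : Fin d → ℝ) (s : ℝ) =>
      sliceIntegrand d τ (fun v => Ψ v s) u)
      ((volume.restrict cube : Measure (Fin d → ℝ)).prod (volume.restrict (Set.Ioc a b))) := by
    refine Integrable.of_bound (C := max M 0) hFm.aestronglyMeasurable ?_
    have hae : ∀ᵐ p : (Fin d → ℝ) × ℝ ∂((volume.restrict cube : Measure (Fin d → ℝ)).prod
        (volume.restrict (Set.Ioc a b))), p ∈ cube ×ˢ Set.Ioc a b := by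
      rw [Measure.prod_restrict]
      exact ae_restrict_mem (hcubem.prod measurableSet_Ioc)
    filter_upwards [hae] with p hp
    rw [Real.norm_eq_abs]; exact hCb _ _ hp.2
  have hswap := integral_integral_swap hFi
  -- restrict the outer `u`-integrals to the cube
  have hL : ∫ u, ∫ s in Set.Ioc a b, sliceIntegrand d τ (fun v => Ψ v s) u =
      ∫ u in cube, ∫ s in Set.Ioc a b, sliceIntegrand d τ (fun v => Ψ v s) u := by
    rw [← integral_indicator hcubem]
    refine integral_congr_ae (Filter.Eventually.of_forall fun u => ?_)
    by_cases hu : u ∈ cube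
    · rw [Set.indicator_of_mem hu]
    · rw [Set.indicator_of_notMem hu]
      simp_rw [hsupp _ u hu]; simp
  have hR : ∫ s in Set.Ioc a b, ∫ u, sliceIntegrand d τ (fun v => Ψ v s) u =
      ∫ s in Set.Ioc a b, ∫ u in cube, sliceIntegrand d τ (fun v => Ψ v s) u := by
    refine integral_congr_ae (Filter.Eventually.of_forall fun s => ?_)
    show ∫ u, sliceIntegrand d τ (fun v => Ψ v s) u = ∫ u in cube, sliceIntegrand d τ (fun v => Ψ v s) u
    rw [← integral_indicator hcubem]
    refine integral_congr_ae (Filter.Eventually.of_forall fun u => ?_)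
    by_cases hu : u ∈ cube
    · rw [Set.indicator_of_mem hu]
    · rw [Set.indicator_of_notMem hu, hsupp s u hu]
  rw [hL, hR, hswap]

/-- `|sliceIntegral d w G| ≤ C R^d` in any dimension, for `w ≤ R`, `R ≥ 1`, `|G| ≤ C`. [folklore] -/
theorem abs_sliceIntegral_le_pow (d : ℕ) {w R : ℝ} (hR : 1 ≤ R) (hwR : w ≤ R)
    {G : (Fin d → ℝ) → ℝ} {C : ℝ} (hC : 0 ≤ C) (hGb : ∀ v, |G v| ≤ C) :
    |sliceIntegral d w G| ≤ C * R ^ d := by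
  cases d with
  | zero => rw [show sliceIntegral 0 w G = 0 from rfl, abs_zero]; positivity
  | succ e =>
    refine (abs_sliceIntegral_le' e (by linarith) hwR hC hGb).trans ?_
    rw [pow_succ]
    exact mul_le_mul_of_nonneg_left (le_mul_of_one_le_right (pow_nonneg (by linarith) _) hR) hC

/-! ### The two-block Fubini formula -/

/-- `v ↦ Fin.append v u` is measurable. [folklore] -/
theorem measurable_append_left {m n : ℕ} (u : Fin n → ℝ) :
    Measurable fun v : Fin m → ℝ => (Fin.append v u : Fin (m + n) → ℝ) := by
  refine measurable_pi_iff.2 fun i => ?_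
  refine Fin.addCases (fun l => ?_) (fun r => ?_) i
  · simp only [Fin.append_left]; exact measurable_pi_apply l
  · simp only [Fin.append_right]; exact measurable_const

/-- `u ↦ Fin.append v u` is measurable. [folklore] -/
theorem measurable_append_right {m n : ℕ} (v : Fin m → ℝ) :
    Measurable fun u : Fin n → ℝ => (Fin.append v u : Fin (m + n) → ℝ) := by
  refine measurable_pi_iff.2 fun i => ?_
  refine Fin.addCases (fun l => ?_) (fun r => ?_) i
  · simp only [Fin.append_left]; exact measurable_const
  · simp only [Fin.append_right]; exact measurable_pi_apply r

/-- `(v, u) ↦ Fin.append v u` is (jointly) measurable. (Named `measurable_finAppend` to avoid the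
clash with `FordMaynardLambdaVec.measurable_append`, the sectionwise version.) [folklore] -/
theorem measurable_finAppend {m n : ℕ} :
    Measurable fun p : (Fin m → ℝ) × (Fin n → ℝ) => (Fin.append p.1 p.2 : Fin (m + n) → ℝ) := by
  refine measurable_pi_iff.2 fun i => ?_
  refine Fin.addCases (fun l => ?_) (fun r => ?_) i
  · simp only [Fin.append_left]; exact (measurable_pi_apply l).comp measurable_fst
  · simp only [Fin.append_right]; exact (measurable_pi_apply r).comp measurable_snd

/-- `(v, t) ↦ Fin.snoc v t` is measurable. [folklore] -/
theorem measurable_snoc {n : ℕ} :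
    Measurable fun p : (Fin n → ℝ) × ℝ => (Fin.snoc p.1 p.2 : Fin (n + 1) → ℝ) := by
  refine measurable_pi_iff.2 fun i => ?_
  refine Fin.lastCases ?_ (fun j => ?_) i
  · simp only [Fin.snoc_last]; exact measurable_snd
  · simp only [Fin.snoc_castSucc]; exact (measurable_pi_apply j).comp measurable_fst

/-- **Two-block Fubini formula for slice integrals**: for bounded measurable `G` on
`ℝ^{(a+1)+(b+1)}`,
`∫_{|z| = w} G(z) = ∫_0^w ∫_{|v| = t, v ∈ ℝ^{a+1}} ∫_{|u| = w−t, u ∈ ℝ^{b+1}} G(v, u) dt`. [folklore] -/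
theorem sliceIntegral_append (a : ℕ) :
    ∀ (b : ℕ) (w : ℝ) (G : (Fin (a + 1 + (b + 1)) → ℝ) → ℝ), Measurable G →
      ∀ {C : ℝ}, 0 ≤ C → (∀ v, |G v| ≤ C) →
      sliceIntegral (a + 1 + (b + 1)) w G =
        ∫ t in Set.Ioc 0 w, sliceIntegral (a + 1) t
          (fun v => sliceIntegral (b + 1) (w - t) (fun u => G (Fin.append v u))) := by
  intro b
  induction b with
  | zero =>
    intro w G hG C hC hGb
    rw [sliceIntegral_peel_last (d := a + 1) (by omega) w hG hC (fun v _ _ => hGb v)]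
    -- right side: the inner one-dimensional slice is an evaluation
    have hR : ∀ t, sliceIntegral (a + 1) t
        (fun v => sliceIntegral (0 + 1) (w - t) (fun u => G (Fin.append v u))) =
        sliceIntegral (a + 1) t (fun v => if 0 < w - t then G (Fin.snoc v (w - t)) else 0) := by
      intro t
      congr 1
      funext v
      rw [show sliceIntegral (0 + 1) (w - t) (fun u => G (Fin.append v u)) =
        if 0 < w - t then G (Fin.append v (fun _ => w - t)) else 0 from sliceIntegral_one _ _]
      rw [Fin.append_right_eq_snoc]
    simp_rw [hR]
    -- substitute `t ↦ w − t`
    rcases le_or_gt w 0 with hw | hw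
    · rw [Set.Ioc_eq_empty (by exact not_lt.2 hw), Measure.restrict_empty, integral_zero_measure,
        integral_zero_measure]
    set φ : ℝ → ℝ := fun t => sliceIntegral (a + 1) t
      (fun v => if 0 < w - t then G (Fin.snoc v (w - t)) else 0) with hφ
    have hcongr : ∫ t in Set.Ioc 0 w, sliceIntegral (a + 1) (w - t) (fun v => G (Fin.snoc v t)) =
        ∫ t in Set.Ioc 0 w, φ (w - t) := by
      refine setIntegral_congr_fun measurableSet_Ioc fun s hs => ?_
      simp only [hφ, sub_sub_cancel, if_pos hs.1]
    rw [hcongr, ← intervalIntegral.integral_of_le hw.le, ← intervalIntegral.integral_of_le hw.le,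
      intervalIntegral.integral_comp_sub_left φ w, sub_self, sub_zero]
  | succ b ih =>
    intro w G hG C hC hGb
    rcases le_or_gt w 0 with hw | hw
    · rw [Set.Ioc_eq_empty (by exact not_lt.2 hw), Measure.restrict_empty, integral_zero_measure,
        sliceIntegral_eq_zero_of_nonpos _ hw]
    -- left: peel the last coordinate, then the induction hypothesis
    show sliceIntegral (a + 1 + (b + 1) + 1) w G = _
    rw [sliceIntegral_peel_last (d := a + 1 + (b + 1)) (by omega) w hG hC (fun v _ _ => hGb v)]
    have hIH : ∀ s, sliceIntegral (a + 1 + (b + 1)) (w - s) (fun z => G (Fin.snoc z s)) =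
        ∫ t in Set.Ioc 0 (w - s), sliceIntegral (a + 1) t (fun v => sliceIntegral (b + 1) (w - s - t)
          (fun u => G (Fin.snoc (Fin.append v u) s))) := fun s =>
      ih (w - s) (fun z => G (Fin.snoc z s))
        (hG.comp (measurable_snoc.comp (measurable_id.prodMk measurable_const))) hC (fun z => hGb _)
    simp_rw [hIH]
    -- the common kernel
    set K : ℝ → ℝ → ℝ := fun t s => sliceIntegral (a + 1) t (fun v => sliceIntegral (b + 1) (w - s - t)
      (fun u => G (Fin.snoc (Fin.append v u) s))) with hK
    -- right: peel the last coordinate of the inner slice, then swap with the outer slice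
    have hinner : ∀ t (v : Fin (a + 1) → ℝ), sliceIntegral (b + 1 + 1) (w - t) (fun u => G (Fin.append v u)) =
        ∫ s in Set.Ioc 0 (w - t), sliceIntegral (b + 1) (w - t - s)
          (fun u => G (Fin.snoc (Fin.append v u) s)) := by
      intro t v
      rw [sliceIntegral_peel_last (d := b + 1) (by omega) (w - t) (G := fun u => G (Fin.append v u))
        (hG.comp (measurable_append_right v)) hC (fun u _ _ => hGb _)]
      refine setIntegral_congr_fun measurableSet_Ioc fun s _ => ?_
      congr 1
      funext u
      rw [Fin.append_snoc]
    simp_rw [hinner]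
    have hswap1 : ∀ t ∈ Set.Ioc 0 w, sliceIntegral (a + 1) t (fun v => ∫ s in Set.Ioc 0 (w - t),
        sliceIntegral (b + 1) (w - t - s) (fun u => G (Fin.snoc (Fin.append v u) s))) =
        ∫ s in Set.Ioc 0 (w - t), K t s := by
      intro t ht
      rw [sliceIntegral_setIntegral_swap a t (M := C * w ^ b)
        (Ψ := fun v s => sliceIntegral (b + 1) (w - t - s) (fun u => G (Fin.snoc (Fin.append v u) s)))]
      · refine setIntegral_congr_fun measurableSet_Ioc fun s _ => ?_
        simp only [hK, show w - t - s = w - s - t by ring]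
      · -- measurability of `(v, s) ↦ ∫ …`
        have hm : Measurable fun p : (Fin (a + 1) → ℝ) × ℝ => sliceIntegral (b + 1) (w - t - p.2)
            (fun u => G (Fin.snoc (Fin.append p.1 u) p.2)) := by
          refine measurable_sliceIntegral_param (X := (Fin (a + 1) → ℝ) × ℝ) (b + 1)
            (w := fun p => w - t - p.2) (measurable_const.sub measurable_snd) ?_
          exact hG.comp (measurable_snoc.comp
            ((measurable_finAppend.comp ((measurable_fst.comp measurable_fst).prodMk measurable_snd)).prodMk
              (measurable_snd.comp measurable_fst)))
        exact hm
      · intro v s hs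
        exact abs_sliceIntegral_le' b hw.le (by linarith [hs.1, ht.1]) hC (fun u => hGb _)
    rw [setIntegral_congr_fun measurableSet_Ioc hswap1]
    -- swap the two one-dimensional integrals over the triangle
    refine (setIntegral_antidiag_swap (K := K) ?_ (M := C * w ^ b * w ^ a) ?_).symm
    · have hKm : Measurable fun p : ℝ × ℝ => K p.1 p.2 := by
        rw [hK]
        refine measurable_sliceIntegral_param (X := ℝ × ℝ) (a + 1) (w := fun p => p.1) measurable_fst ?_
        refine measurable_sliceIntegral_param (X := (ℝ × ℝ) × (Fin (a + 1) → ℝ)) (b + 1)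
          (w := fun q => w - q.1.2 - q.1.1)
          (((measurable_const.sub (measurable_snd.comp measurable_fst)).sub (measurable_fst.comp measurable_fst))) ?_
        exact hG.comp (measurable_snoc.comp
          ((measurable_finAppend.comp ((measurable_snd.comp measurable_fst).prodMk measurable_snd)).prodMk
            (measurable_snd.comp (measurable_fst.comp measurable_fst))))
      exact hKm
    · intro t ht s hs
      rw [hK]
      refine abs_sliceIntegral_le' a hw.le ht.2 (by positivity) fun v => ?_
      exact abs_sliceIntegral_le' b hw.le (by linarith [hs.1, ht.1]) hC (fun u => hGb _)

/-! ### Iterated product-slice integrals with consecutive blocks -/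

/-- Total size `h₀ + ⋯ + h_{s−1}` of a block-size vector, defined recursively so that
`bsum (s+1) h = bsum s (init h) + h (last s)` definitionally. [folklore] -/
def bsum : (s : ℕ) → (Fin s → ℕ) → ℕ
  | 0, _ => 0
  | s + 1, h => bsum s (Fin.init h) + h (Fin.last s)

/-- `bsum s h = ∑ j, h j`. [folklore] -/
theorem bsum_eq_sum : ∀ (s : ℕ) (h : Fin s → ℕ), bsum s h = ∑ j, h j
  | 0, _ => by simp [bsum]
  | s + 1, h => by
    rw [bsum, bsum_eq_sum s, Fin.sum_univ_castSucc]
    rfl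

/-- **Iterated product-slice integral** over consecutive blocks: for block sizes `h₀,…,h_{s−1}`
and block totals `ψ₀,…,ψ_{s−1}`,
`multiSlice s h ψ H = ∫_{v₀ ∈ Δ_{h₀}(ψ₀)} ⋯ ∫_{v_{s−1} ∈ Δ_{h_{s−1}}(ψ_{s−1})} H(v₀, …, v_{s−1})`
(`Δ_k(t) = {v ∈ (0,∞)^k : |v| = t}` with the slice measure of `sliceIntegral`). This is the
integration "`ξ_j = u_{j,1} + ⋯ + u_{j,k_j}`, `1 ≤ j ≤ m`" of Ford–Maynard's fragmentation
relations (arXiv:2407.14368, (fsl) and (6.3)), with unordered block variables. [folklore] -/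
def multiSlice : (s : ℕ) → (h : Fin s → ℕ) → (ψ : Fin s → ℝ) → ((Fin (bsum s h) → ℝ) → ℝ) → ℝ
  | 0, _, _, H => H Fin.elim0
  | s + 1, h, ψ, H => multiSlice s (Fin.init h) (Fin.init ψ)
      (fun β => sliceIntegral (h (Fin.last s)) (ψ (Fin.last s)) (fun v => H (Fin.append β v)))

/-- `multiSlice` with no blocks is evaluation at the empty vector. [folklore] -/
theorem multiSlice_zero (h : Fin 0 → ℕ) (ψ : Fin 0 → ℝ) (H : (Fin (bsum 0 h) → ℝ) → ℝ) :
    multiSlice 0 h ψ H = H Fin.elim0 := rfl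

/-- The defining recursion of `multiSlice` (peeling the last block). [folklore] -/
theorem multiSlice_succ (s : ℕ) (h : Fin (s + 1) → ℕ) (ψ : Fin (s + 1) → ℝ)
    (H : (Fin (bsum (s + 1) h) → ℝ) → ℝ) :
    multiSlice (s + 1) h ψ H = multiSlice s (Fin.init h) (Fin.init ψ)
      (fun β => sliceIntegral (h (Fin.last s)) (ψ (Fin.last s)) (fun v => H (Fin.append β v))) := rfl

/-- Joint measurability of `multiSlice` in parameters. [folklore] -/
theorem measurable_multiSlice_param {X : Type*} [MeasurableSpace X] :
    ∀ (s : ℕ) (h : Fin s → ℕ) {ψ : X → Fin s → ℝ}, Measurable ψ →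
      ∀ {H : X → (Fin (bsum s h) → ℝ) → ℝ}, Measurable (fun q : X × (Fin (bsum s h) → ℝ) => H q.1 q.2) →
      Measurable fun x => multiSlice s h (ψ x) (H x)
  | 0, h, ψ, _, H, hH => by
    simp only [multiSlice_zero]
    exact hH.comp (measurable_id.prodMk measurable_const)
  | s + 1, h, ψ, hψ, H, hH => by
    simp only [multiSlice_succ]
    refine measurable_multiSlice_param s (Fin.init h) (ψ := fun x => Fin.init (ψ x))
      (measurable_pi_iff.2 fun i => (measurable_pi_apply _).comp hψ) ?_
    refine measurable_sliceIntegral_param (X := X × (Fin (bsum s (Fin.init h)) → ℝ)) (h (Fin.last s))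
      (w := fun q => ψ q.1 (Fin.last s)) ((measurable_pi_apply _).comp (hψ.comp measurable_fst)) ?_
    exact hH.comp ((measurable_fst.comp measurable_fst).prodMk
      (measurable_finAppend.comp ((measurable_snd.comp measurable_fst).prodMk measurable_snd)))

/-- A crude bound for `multiSlice`. [folklore] -/
theorem abs_multiSlice_le :
    ∀ (s : ℕ) (h : Fin s → ℕ) {ψ : Fin s → ℝ} {R : ℝ}, 1 ≤ R → (∀ j, ψ j ≤ R) →
      ∀ {H : (Fin (bsum s h) → ℝ) → ℝ} {C : ℝ}, 0 ≤ C → (∀ β, |H β| ≤ C) →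
      |multiSlice s h ψ H| ≤ C * R ^ bsum s h
  | 0, h, ψ, R, _, _, H, C, _, hHb => by simpa [multiSlice_zero, bsum] using hHb _
  | s + 1, h, ψ, R, hR, hψ, H, C, hC, hHb => by
    rw [multiSlice_succ]
    have hb : ∀ β, |sliceIntegral (h (Fin.last s)) (ψ (Fin.last s)) (fun v => H (Fin.append β v))|
        ≤ C * R ^ h (Fin.last s) := fun β =>
      abs_sliceIntegral_le_pow (h (Fin.last s)) hR (hψ _) hC (fun v => hHb _)
    refine (abs_multiSlice_le s (Fin.init h) hR (fun j => hψ _) (by positivity) hb).trans ?_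
    rw [show bsum (s + 1) h = bsum s (Fin.init h) + h (Fin.last s) from rfl, pow_add]
    ring_nf
    rfl

/-- Casts compose inside `Fin.append`. [folklore] -/
theorem append_comp_cast {a b m n : ℕ} (ha : m = a) (hb : n = b) (v : Fin a → ℝ) (u : Fin b → ℝ) :
    Fin.append (v ∘ Fin.cast ha) (u ∘ Fin.cast hb) =
      Fin.append v u ∘ Fin.cast (show m + n = a + b by rw [ha, hb]) := by
  subst ha; subst hb; rfl

/-- **Multi-block Fubini formula**: integrating the block totals `ψ ∈ Δ_s(w)` and then each block
over its slice is integrating the flat vector over `Δ_{h₀+⋯+h_{s−1}}(w)`: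
`∫_{ψ ∈ Δ_s(w)} multiSlice s h ψ H = ∫_{β ∈ Δ_{Σh}(w)} H(β)` (all `h_j ≥ 1`, `H` bounded
measurable). [folklore] -/
theorem sliceIntegral_multiSlice {s : ℕ} (hs : 1 ≤ s) :
    ∀ (h : Fin s → ℕ), (∀ j, 1 ≤ h j) → ∀ (w : ℝ) (H : (Fin (bsum s h) → ℝ) → ℝ), Measurable H →
      ∀ {C : ℝ}, 0 ≤ C → (∀ β, |H β| ≤ C) →
      sliceIntegral s w (fun ψ => multiSlice s h ψ H) = sliceIntegral (bsum s h) w H := by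
  induction s, hs using Nat.le_induction with
  | base =>
    intro h hh w H hH C hC hHb
    -- `multiSlice 1 h ψ H = sliceIntegral (h 0) (ψ 0) (v ↦ H (append elim0 v))`
    have h1 : ∀ ψ : Fin 1 → ℝ, multiSlice 1 h ψ H =
        sliceIntegral (h (Fin.last 0)) (ψ (Fin.last 0)) (fun v => H (v ∘ Fin.cast (Nat.zero_add _))) := by
      intro ψ
      rw [multiSlice_succ, multiSlice_zero]
      congr 1
      funext v
      exact congrArg H (Fin.elim0_append v)
    simp_rw [h1]
    rw [sliceIntegral_one]
    split_ifs with hw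
    · exact sliceIntegral_comp_cast (Nat.zero_add _) w H
    · exact (sliceIntegral_eq_zero_of_nonpos _ (not_lt.1 hw) H).symm
  | succ s hs ih =>
    intro h hh w H hH C hC hHb
    rw [sliceIntegral_peel_last (d := s) hs w (C := C * max w 1 ^ bsum (s + 1) h)
      (G := fun ψ => multiSlice (s + 1) h ψ H)]
    rotate_left
    · exact measurable_multiSlice_param (X := Fin (s + 1) → ℝ) (s + 1) h measurable_id
        (hH.comp measurable_snd)
    · positivity
    · intro ψ hψ hsum
      refine abs_multiSlice_le (s + 1) h (le_max_right _ _) (fun j => ?_) hC hHb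
      refine le_trans ?_ (le_max_left _ _)
      rw [← hsum]
      exact Finset.single_le_sum (fun i _ => (hψ i).le) (Finset.mem_univ j)
    -- inside: `init (snoc ψ' t) = ψ'`, `snoc ψ' t (last) = t`, then the induction hypothesis
    have hin : ∀ t (ψ' : Fin s → ℝ), multiSlice (s + 1) h (Fin.snoc ψ' t) H =
        multiSlice s (Fin.init h) ψ'
          (fun β => sliceIntegral (h (Fin.last s)) t (fun v => H (Fin.append β v))) := by
      intro t ψ'
      rw [multiSlice_succ, Fin.init_snoc, Fin.snoc_last]
    simp_rw [hin]
    have hIH : ∀ t, sliceIntegral s (w - t) (fun ψ' => multiSlice s (Fin.init h) ψ'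
        (fun β => sliceIntegral (h (Fin.last s)) t (fun v => H (Fin.append β v)))) =
        sliceIntegral (bsum s (Fin.init h)) (w - t)
          (fun β => sliceIntegral (h (Fin.last s)) t (fun v => H (Fin.append β v))) := by
      intro t
      refine ih (Fin.init h) (fun j => hh _) (w - t) _ ?_ (C := C * max t 1 ^ h (Fin.last s))
        (by positivity) fun β => ?_
      · exact measurable_sliceIntegral_param (X := Fin (bsum s (Fin.init h)) → ℝ) (h (Fin.last s))
          measurable_const (hH.comp measurable_finAppend)
      · exact abs_sliceIntegral_le_pow _ (le_max_right _ _) (le_max_left _ _) hC (fun v => hHb _)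
    simp_rw [hIH]
    -- right side: two-block formula after casting the block sizes to successor form
    obtain ⟨a, ha⟩ : ∃ a, bsum s (Fin.init h) = a + 1 := by
      obtain ⟨s', rfl⟩ : ∃ s', s = s' + 1 := ⟨s - 1, by omega⟩
      refine ⟨bsum (s' + 1) (Fin.init h) - 1, ?_⟩
      have : 1 ≤ bsum (s' + 1) (Fin.init h) := by
        rw [show bsum (s' + 1) (Fin.init h) = bsum s' (Fin.init (Fin.init h)) + Fin.init h (Fin.last s')
          from rfl]
        have := hh (Fin.castSucc (Fin.last s'))
        simp only [Fin.init] at this ⊢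
        omega
      omega
    obtain ⟨b, hb⟩ : ∃ b, h (Fin.last s) = b + 1 := ⟨h (Fin.last s) - 1, by have := hh (Fin.last s); omega⟩
    have hdim : bsum (s + 1) h = bsum s (Fin.init h) + h (Fin.last s) := rfl
    have hcast : a + 1 + (b + 1) = bsum (s + 1) h := by rw [hdim, ha, hb]
    rw [← sliceIntegral_comp_cast hcast.symm w H,
      sliceIntegral_append a b w (fun z => H (z ∘ Fin.cast hcast.symm))
        (hH.comp (measurable_pi_iff.2 fun i => measurable_pi_apply _)) hC (fun z => hHb _)]
    -- move the casts onto the blocks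
    have hblk : ∀ t, sliceIntegral (a + 1) t (fun v => sliceIntegral (b + 1) (w - t)
        (fun u => H (Fin.append v u ∘ Fin.cast hcast.symm))) =
        sliceIntegral (bsum s (Fin.init h)) t (fun v' => sliceIntegral (h (Fin.last s)) (w - t)
          (fun u' => H (Fin.append v' u'))) := by
      intro t
      rw [← sliceIntegral_comp_cast ha t]
      congr 1
      funext v
      rw [← sliceIntegral_comp_cast hb (w - t)]
      congr 1
      funext u
      rw [append_comp_cast ha hb v u]
      rfl
    simp_rw [hblk]
    -- substitute `t ↦ w − t`
    rcases le_or_gt w 0 with hw | hw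
    · rw [Set.Ioc_eq_empty (by exact not_lt.2 hw), Measure.restrict_empty, integral_zero_measure,
        integral_zero_measure]
    set φ : ℝ → ℝ := fun t => sliceIntegral (bsum s (Fin.init h)) t (fun v' =>
      sliceIntegral (h (Fin.last s)) (w - t) (fun u' => H (Fin.append v' u'))) with hφ
    have hcongr : ∫ t in Set.Ioc 0 w, sliceIntegral (bsum s (Fin.init h)) (w - t)
        (fun β => sliceIntegral (h (Fin.last s)) t (fun v => H (Fin.append β v))) =
        ∫ t in Set.Ioc 0 w, φ (w - t) := by
      refine setIntegral_congr_fun measurableSet_Ioc fun t _ => ?_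
      simp only [hφ, sub_sub_cancel]
    rw [hcongr, ← intervalIntegral.integral_of_le hw.le, ← intervalIntegral.integral_of_le hw.le,
      intervalIntegral.integral_comp_sub_left φ w, sub_self, sub_zero]

/-! ### Linearity of `multiSlice` -/

/-- Additivity of slice integrals in any dimension (bounded measurable integrands). [folklore] -/
theorem sliceIntegral_add' (d : ℕ) (w : ℝ) {G G' : (Fin d → ℝ) → ℝ} (hG : Measurable G)
    (hG' : Measurable G') {C : ℝ} (hGb : ∀ v, |G v| ≤ C) (hG'b : ∀ v, |G' v| ≤ C) :
    sliceIntegral d w (fun v => G v + G' v) = sliceIntegral d w G + sliceIntegral d w G' := by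
  cases d with
  | zero => simp [show ∀ K : (Fin 0 → ℝ) → ℝ, sliceIntegral 0 w K = 0 from fun K => rfl]
  | succ e =>
    exact sliceIntegral_add e w hG hG' (abs_nonneg C) (fun v _ _ => (hGb v).trans (le_abs_self C))
      (fun v _ _ => (hG'b v).trans (le_abs_self C))

/-- `multiSlice` only depends on the integrand pointwise. [folklore] -/
theorem multiSlice_congr :
    ∀ (s : ℕ) (h : Fin s → ℕ) (ψ : Fin s → ℝ) {H H' : (Fin (bsum s h) → ℝ) → ℝ},
      (∀ β, H β = H' β) → multiSlice s h ψ H = multiSlice s h ψ H'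
  | s, h, ψ, H, H', hH => by rw [show H = H' from funext hH]

/-- Scalars pull out of `multiSlice`. [folklore] -/
theorem multiSlice_const_mul :
    ∀ (s : ℕ) (h : Fin s → ℕ) (ψ : Fin s → ℝ) (c : ℝ) (H : (Fin (bsum s h) → ℝ) → ℝ),
      multiSlice s h ψ (fun β => c * H β) = c * multiSlice s h ψ H
  | 0, h, ψ, c, H => rfl
  | s + 1, h, ψ, c, H => by
    rw [multiSlice_succ, multiSlice_succ, ← multiSlice_const_mul s]
    congr 1
    funext β
    rw [← sliceIntegral_const_mul]

/-- Additivity of `multiSlice` (bounded measurable integrands). [folklore] -/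
theorem multiSlice_add :
    ∀ (s : ℕ) (h : Fin s → ℕ) (ψ : Fin s → ℝ) (H H' : (Fin (bsum s h) → ℝ) → ℝ),
      Measurable H → Measurable H' → ∀ {C : ℝ}, (∀ β, |H β| ≤ C) → (∀ β, |H' β| ≤ C) →
      multiSlice s h ψ (fun β => H β + H' β) = multiSlice s h ψ H + multiSlice s h ψ H'
  | 0, h, ψ, H, H', _, _, C, _, _ => rfl
  | s + 1, h, ψ, H, H', hH, hH', C, hHb, hH'b => by
    rw [multiSlice_succ, multiSlice_succ, multiSlice_succ]
    have hm : ∀ G : (Fin (bsum (s + 1) h) → ℝ) → ℝ, Measurable G →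
        Measurable fun β : Fin (bsum s (Fin.init h)) → ℝ =>
          sliceIntegral (h (Fin.last s)) (ψ (Fin.last s)) (fun v => G (Fin.append β v)) := fun G hG =>
      measurable_sliceIntegral_param (X := Fin (bsum s (Fin.init h)) → ℝ) (h (Fin.last s))
        measurable_const (hG.comp measurable_finAppend)
    have hb : ∀ G : (Fin (bsum (s + 1) h) → ℝ) → ℝ, (∀ β, |G β| ≤ C) →
        ∀ β : Fin (bsum s (Fin.init h)) → ℝ,
          |sliceIntegral (h (Fin.last s)) (ψ (Fin.last s)) (fun v => G (Fin.append β v))| ≤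
            |C| * max (ψ (Fin.last s)) 1 ^ h (Fin.last s) := fun G hGb β =>
      abs_sliceIntegral_le_pow _ (le_max_right _ _) (le_max_left _ _) (abs_nonneg C)
        (fun v => (hGb _).trans (le_abs_self C))
    rw [← multiSlice_add s (Fin.init h) (Fin.init ψ) _ _ (hm H hH) (hm H' hH') (hb H hHb) (hb H' hH'b)]
    refine multiSlice_congr s _ _ fun β => ?_
    exact sliceIntegral_add' _ _ (hH.comp (measurable_append_right β))
      (hH'.comp (measurable_append_right β)) (fun v => hHb _) (fun v => hH'b _)

/-- `multiSlice` of the zero function vanishes. [folklore] -/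
theorem multiSlice_zero_fun :
    ∀ (s : ℕ) (h : Fin s → ℕ) (ψ : Fin s → ℝ), multiSlice s h ψ (fun _ => 0) = 0
  | 0, h, ψ => rfl
  | s + 1, h, ψ => by
    rw [multiSlice_succ]
    have : (fun β : Fin (bsum s (Fin.init h)) → ℝ =>
        sliceIntegral (h (Fin.last s)) (ψ (Fin.last s)) (fun _ => (0 : ℝ))) = fun _ => 0 := by
      funext β
      exact sliceIntegral_zero _ _
    rw [this, multiSlice_zero_fun s]

/-- `multiSlice` commutes with finite sums (bounded measurable integrands). [folklore] -/
theorem multiSlice_sum {ι : Type*} (T : Finset ι) :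
    ∀ (s : ℕ) (h : Fin s → ℕ) (ψ : Fin s → ℝ) (H : ι → (Fin (bsum s h) → ℝ) → ℝ),
      (∀ i, Measurable (H i)) → ∀ {C : ℝ}, (∀ i β, |H i β| ≤ C) →
      multiSlice s h ψ (fun β => ∑ i ∈ T, H i β) = ∑ i ∈ T, multiSlice s h ψ (H i) := by
  classical
  intro s h ψ H hH C hHb
  induction T using Finset.induction_on with
  | empty => simp [multiSlice_zero_fun]
  | insert a T ha ih =>
    simp_rw [Finset.sum_insert ha]
    rw [← ih]
    refine multiSlice_add s h ψ (H a) (fun β => ∑ i ∈ T, H i β) (hH a)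
      (Finset.measurable_sum _ fun i _ => hH i) (C := max C 0 * (T.card + 1)) (fun β => ?_) (fun β => ?_)
    · refine (hHb a β).trans ?_
      have : (0 : ℝ) ≤ T.card := by positivity
      nlinarith [le_max_left C 0, le_max_right C 0]
    · refine (Finset.abs_sum_le_sum_abs _ _).trans ?_
      refine (Finset.sum_le_sum fun i _ => (hHb i β).trans (le_max_left C 0)).trans ?_
      rw [Finset.sum_const, nsmul_eq_mul]
      nlinarith [le_max_right C 0]

/-! ### Fubini between slice integrals, and between `multiSlice` and a slice integral -/

/-- **Fubini for two slice integrals** (bounded jointly measurable integrand). [folklore] -/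
theorem sliceIntegral_sliceIntegral_swap (d e : ℕ) (τ w : ℝ) {Ψ : (Fin d → ℝ) → (Fin e → ℝ) → ℝ}
    (hΨ : Measurable (Function.uncurry Ψ)) {M : ℝ} (hM : ∀ v u, |Ψ v u| ≤ M) :
    sliceIntegral d τ (fun v => sliceIntegral e w (fun u => Ψ v u)) =
      sliceIntegral e w (fun u => sliceIntegral d τ (fun v => Ψ v u)) := by
  cases d with
  | zero =>
    show (0 : ℝ) = sliceIntegral e w (fun u => 0)
    rw [sliceIntegral_zero]
  | succ d =>
  cases e with
  | zero =>
    show sliceIntegral (d + 1) τ (fun v => 0) = 0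
    rw [sliceIntegral_zero]
  | succ e =>
  rw [sliceIntegral_succ_eq, sliceIntegral_succ_eq]
  simp_rw [sliceIntegral_succ_eq]
  -- slice integrands of parametric integrals
  have hptL : ∀ x : Fin d → ℝ, sliceIntegrand d τ (fun v => ∫ y, sliceIntegrand e w (fun u => Ψ v u) y) x =
      ∫ y, sliceIntegrand d τ (fun v => sliceIntegrand e w (fun u => Ψ v u) y) x := by
    intro x; unfold sliceIntegrand; split_ifs <;> simp
  have hptR : ∀ y : Fin e → ℝ, sliceIntegrand e w (fun u => ∫ x, sliceIntegrand d τ (fun v => Ψ v u) x) y =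
      ∫ x, sliceIntegrand e w (fun u => sliceIntegrand d τ (fun v => Ψ v u) x) y := by
    intro y; unfold sliceIntegrand; split_ifs <;> simp
  simp_rw [hptL, hptR]
  -- the common kernel and its support
  set F : (Fin d → ℝ) → (Fin e → ℝ) → ℝ := fun x y =>
    sliceIntegrand d τ (fun v => sliceIntegrand e w (fun u => Ψ v u) y) x with hF
  have hFR : ∀ x y, sliceIntegrand e w (fun u => sliceIntegrand d τ (fun v => Ψ v u) x) y = F x y := by
    intro x y; simp only [hF]; unfold sliceIntegrand; split_ifs <;> rfl
  simp_rw [hFR]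
  set cubeX : Set (Fin d → ℝ) := Set.pi Set.univ fun _ => Set.Ioo 0 τ with hcubeX
  set cubeY : Set (Fin e → ℝ) := Set.pi Set.univ fun _ => Set.Ioo 0 w with hcubeY
  have hmX : MeasurableSet cubeX := MeasurableSet.univ_pi fun _ => measurableSet_Ioo
  have hmY : MeasurableSet cubeY := MeasurableSet.univ_pi fun _ => measurableSet_Ioo
  have hfinX : volume cubeX < ⊤ := by rw [hcubeX, Real.volume_pi_Ioo]; simp [ENNReal.ofReal_lt_top]
  have hfinY : volume cubeY < ⊤ := by rw [hcubeY, Real.volume_pi_Ioo]; simp [ENNReal.ofReal_lt_top]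
  have hsuppX : ∀ x y, x ∉ cubeX → F x y = 0 := by
    intro x y hx; simp only [hF]
    apply sliceIntegrand_eq_zero; intro h'; apply hx; rw [hcubeX, Set.mem_univ_pi]; exact fun i => h' i
  have hsuppY : ∀ x y, y ∉ cubeY → F x y = 0 := by
    intro x y hy; rw [← hFR]
    apply sliceIntegrand_eq_zero; intro h'; apply hy; rw [hcubeY, Set.mem_univ_pi]; exact fun i => h' i
  haveI : IsFiniteMeasure (volume.restrict cubeX : Measure (Fin d → ℝ)) :=
    ⟨by rw [Measure.restrict_apply_univ]; exact hfinX⟩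
  haveI : IsFiniteMeasure (volume.restrict cubeY : Measure (Fin e → ℝ)) :=
    ⟨by rw [Measure.restrict_apply_univ]; exact hfinY⟩
  have hFm : Measurable (Function.uncurry F) := by
    simp only [hF]
    refine measurable_sliceIntegrand_param (X := (Fin d → ℝ) × (Fin e → ℝ)) d (w := fun _ => τ)
      measurable_const (G := fun q v => sliceIntegrand e w (fun u => Ψ v u) q.2) ?_ |>.comp
      (measurable_id.prodMk measurable_fst)
    -- `(q, v) ↦ sliceIntegrand e w (Ψ v ·) q.2`
    have := measurable_sliceIntegrand_param (X := ((Fin d → ℝ) × (Fin e → ℝ)) × (Fin (d + 1) → ℝ)) e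
      (w := fun _ => w) measurable_const (G := fun p u => Ψ p.2 u)
      (hΨ.comp ((measurable_snd.comp measurable_fst).prodMk measurable_snd))
    exact this.comp (measurable_id.prodMk (measurable_snd.comp measurable_fst))
  have hFb : ∀ x y, |F x y| ≤ max M 0 := by
    intro x y; simp only [hF]; unfold sliceIntegrand
    split_ifs
    · exact (hM _ _).trans (le_max_left _ _)
    all_goals simp
  have hFi : Integrable (Function.uncurry F)
      ((volume.restrict cubeX : Measure (Fin d → ℝ)).prod (volume.restrict cubeY)) :=
    Integrable.of_bound (C := max M 0) hFm.aestronglyMeasurable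
      (Filter.Eventually.of_forall fun p => by rw [Real.norm_eq_abs]; exact hFb _ _)
  have hswap := integral_integral_swap hFi
  have hL : ∫ x, ∫ y, F x y = ∫ x in cubeX, ∫ y in cubeY, F x y := by
    rw [← integral_indicator hmX]
    refine integral_congr_ae (Filter.Eventually.of_forall fun x => ?_)
    by_cases hx : x ∈ cubeX
    · rw [Set.indicator_of_mem hx, ← integral_indicator hmY]
      refine integral_congr_ae (Filter.Eventually.of_forall fun y => ?_)
      by_cases hy : y ∈ cubeY
      · rw [Set.indicator_of_mem hy]
      · rw [Set.indicator_of_notMem hy]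
        show F x y = 0
        exact hsuppY x y hy
    · rw [Set.indicator_of_notMem hx]
      show ∫ y, F x y = 0
      simp_rw [hsuppX x _ hx]; simp
  have hR : ∫ y, ∫ x, F x y = ∫ y in cubeY, ∫ x in cubeX, F x y := by
    rw [← integral_indicator hmY]
    refine integral_congr_ae (Filter.Eventually.of_forall fun y => ?_)
    by_cases hy : y ∈ cubeY
    · rw [Set.indicator_of_mem hy, ← integral_indicator hmX]
      refine integral_congr_ae (Filter.Eventually.of_forall fun x => ?_)
      by_cases hx : x ∈ cubeX
      · rw [Set.indicator_of_mem hx]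
      · rw [Set.indicator_of_notMem hx]
        show F x y = 0
        exact hsuppX x y hx
    · rw [Set.indicator_of_notMem hy]
      show ∫ x, F x y = 0
      simp_rw [hsuppY _ y hy]; simp
  rw [hL, hR, hswap]

/-- **`multiSlice` commutes with an outer slice integral** (bounded jointly measurable
integrand). [folklore] -/
theorem sliceIntegral_multiSlice_swap (e : ℕ) (w : ℝ) :
    ∀ (r : ℕ) (k : Fin r → ℕ) (ξ : Fin r → ℝ) {Φ : (Fin (bsum r k) → ℝ) → (Fin e → ℝ) → ℝ},
      Measurable (Function.uncurry Φ) → ∀ {M : ℝ}, (∀ β u, |Φ β u| ≤ M) →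
      sliceIntegral e w (fun u => multiSlice r k ξ (fun β => Φ β u)) =
        multiSlice r k ξ (fun β => sliceIntegral e w (fun u => Φ β u))
  | 0, k, ξ, Φ, _, M, _ => rfl
  | r + 1, k, ξ, Φ, hΦ, M, hM => by
    simp only [multiSlice_succ]
    -- induction hypothesis with `Φ' β' u = ∫_{v} Φ (append β' v) u`
    have hm : Measurable (Function.uncurry fun (β' : Fin (bsum r (Fin.init k)) → ℝ) (u : Fin e → ℝ) =>
        sliceIntegral (k (Fin.last r)) (ξ (Fin.last r)) (fun v => Φ (Fin.append β' v) u)) := by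
      refine measurable_sliceIntegral_param (X := (Fin (bsum r (Fin.init k)) → ℝ) × (Fin e → ℝ))
        (k (Fin.last r)) (w := fun _ => ξ (Fin.last r)) measurable_const ?_
      exact hΦ.comp ((measurable_finAppend.comp ((measurable_fst.comp measurable_fst).prodMk
        measurable_snd)).prodMk (measurable_snd.comp measurable_fst))
    have hb : ∀ (β' : Fin (bsum r (Fin.init k)) → ℝ) (u : Fin e → ℝ),
        |sliceIntegral (k (Fin.last r)) (ξ (Fin.last r)) (fun v => Φ (Fin.append β' v) u)| ≤
          |M| * max (ξ (Fin.last r)) 1 ^ k (Fin.last r) := fun β' u =>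
      abs_sliceIntegral_le_pow _ (le_max_right _ _) (le_max_left _ _) (abs_nonneg M)
        (fun v => (hM _ _).trans (le_abs_self M))
    rw [sliceIntegral_multiSlice_swap e w r (Fin.init k) (Fin.init ξ) hm hb]
    refine multiSlice_congr r _ _ fun β' => ?_
    exact sliceIntegral_sliceIntegral_swap e (k (Fin.last r)) w (ξ (Fin.last r))
      (Ψ := fun u v => Φ (Fin.append β' v) u)
      (hΦ.comp ((measurable_finAppend.comp (measurable_const.prodMk measurable_snd)).prodMk measurable_fst))
      (fun u v => hM _ _)

end Literature.NumberTheory.Sieve.FordMaynard
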